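import Literature.NumberTheory.LFunctions.LargeValuesRFunction
import Literature.NumberTheory.LFunctions.LargeValuesGuthMaynardReduction
import Literature.NumberTheory.LFunctions.DoubleZetaSumMajorant
import Mathlib.Analysis.Fourier.Inversion
import Mathlib.Analysis.Calculus.BumpFunction.Basic
import HarnessLib

/-!
# Energy controlled by the discrete third moment (Guth–Maynard Lemmas 11.3 and 11.4)

Topic `NumberTheory/LFunctions`, family RH. `LargeValuesAssembly.lean` reduces the tree's named fact
`Literature.NumberTheory.LFunctions.zeroDensity_guth_maynard` (Guth–Maynard, Theorem 1.2) to
Propositions 6.1, 10.1 and 11.1 of L. Guth, J. Maynard, *New large value estimates for Dirichlet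
polynomials*, Ann. of Math. 203 (2026). This file PROVES the first two lemmas of §11 (the part of
the proof of Proposition 11.1, "Bound for energy", that does not use Heath-Brown's theorem):

* **Lemma 11.3 (Dirichlet polynomials do not vary too fast)**, in the exact form
  `D(t) = ∫ e(−v log N/2π) ψ̂(v) D(t+v) dv` for `D(t) = ∑_{N≤n≤2N} b_n n^{it}` and a smooth compactly
  supported bump `ψ` equal to `1` on `[0, log 2/(2π)]` (`smoothing_identity`, by Fourier inversion,
  Mathlib's `Continuous.fourierInv_fourier_eq`), with the consequence
  `|D(t)|² ≤ A ∫ |ψ̂(v)| |D(t+v)|² dv`, `A = max(1, ‖ψ̂‖₁)` (`smoothing_bound`);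
* **Lemma 11.4 (Energy controlled by discrete third moment)**:
  `E(W) ≤ C N^{-2σ} ∑_{n₁,n₂∈[N,2N]} |R(n₁/n₂)|³` for `1`-bounded `b_n`, finite `1`-separated `W` with
  `|D(t)| ≥ N^σ` on `W` (`energy_le_third_moment`, `energy_le_third_moment_abs` with an absolute `C`),
  where `E(W) = #{(t₁,…,t₄) ∈ W⁴ : |t₁+t₂−t₃−t₄| ≤ 1}` (the expression of `GuthMaynardAssembly.addEnergy`)
  and `R` is `GuthMaynardRFunction.Rfun`. The proof is the paper's: `E(W) ≤ N^{-2σ}∑|D(t₄)|²`, the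
  smoothing bound, at most `3` admissible `t₄` for given `t₁,t₂,t₃` (`card_near_le_three`), exchange of
  sum and integral, and the cubic `R`-bound
  `∑_{t₁,t₂,t₃} |D(t₁+t₂−t₃+s)|² ≤ ∑_{n₁,n₂} |R(n₁/n₂)|³` (`triple_sum_normSq_le`, using `|b_n| ≤ 1`);
  since the weight `|ψ̂|` is kept inside the integral there is no `T^{o(1)}` loss.

No definition and no named fact is introduced; everything here is proved.

## References

* L. Guth, J. Maynard, *New large value estimates for Dirichlet polynomials*, Ann. of Math. (2)
  203 (2026), no. 2; arXiv:2405.20552 (2024): §11, Lemmas 11.3 and 11.4 and their proofs.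
-/

noncomputable section

open Real Set Filter Topology Complex MeasureTheory Finset
open scoped FourierTransform ContDiff

namespace Literature.NumberTheory.LFunctions

namespace GuthMaynardEnergy

open GuthMaynardFourier GuthMaynardRFunction

/-! ## §1. Dirichlet polynomials do not vary too fast (Guth–Maynard Lemma 11.3) -/

/-- `e(v·log n/2π) = n^{iv}` for `n ≥ 1`. [folklore] -/
theorem fourierChar_mul_log (n : ℕ) (hn : n ≠ 0) (v : ℝ) :
    ((𝐞 (v * (Real.log n / (2 * π))) : ℂ)) = (n : ℂ) ^ ((v : ℂ) * I) := by
  rw [Real.fourierChar_apply, Complex.cpow_def_of_ne_zero (by exact_mod_cast hn),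
    ← Complex.ofReal_natCast, ← Complex.ofReal_log (Nat.cast_nonneg n)]
  congr 1
  have hπ : (π : ℝ) ≠ 0 := Real.pi_pos.ne'
  have : 2 * π * (v * (Real.log n / (2 * π))) = Real.log n * v := by field_simp
  rw [this]; push_cast; ring

/-- `n^{it} n^{iv} = n^{i(t+v)}` for `n ≥ 1`. [folklore] -/
theorem natCast_cpow_mul_I_add (n : ℕ) (hn : n ≠ 0) (t v : ℝ) :
    (n : ℂ) ^ ((t : ℂ) * I) * (n : ℂ) ^ ((v : ℂ) * I) = (n : ℂ) ^ ((((t + v : ℝ)) : ℂ) * I) := by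
  rw [← Complex.cpow_add _ _ (by exact_mod_cast hn)]
  congr 1; push_cast; ring

section bump

variable {ψ : ℝ → ℝ}

/-- The complexified bump is integrable. [folklore] -/
theorem integrable_ofReal_bump (hψ : ContDiff ℝ ∞ ψ) (hψs : HasCompactSupport ψ) :
    Integrable (fun x ↦ (ψ x : ℂ)) :=
  (Complex.continuous_ofReal.comp hψ.continuous).integrable_of_hasCompactSupport
    (hψs.comp_left Complex.ofReal_zero)

/-- The Fourier transform of a smooth compactly supported bump is bounded by an integrable
majorant `K min(1, |ξ|^{-2})`. [folklore] -/
theorem exists_majorant_fourier_bump (hψ : ContDiff ℝ ∞ ψ) (hψs : HasCompactSupport ψ) :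
    ∃ K, 0 ≤ K ∧ (∀ ξ, ‖𝓕 (fun x ↦ (ψ x : ℂ)) ξ‖ ≤ K) ∧
      (∀ ξ, ξ ≠ 0 → ‖𝓕 (fun x ↦ (ψ x : ℂ)) ξ‖ ≤ K / |ξ| ^ 2) := by
  have hc : ContDiff ℝ ∞ (fun x ↦ (ψ x : ℂ)) := Complex.ofRealCLM.contDiff.comp hψ
  have hs : HasCompactSupport (fun x ↦ (ψ x : ℂ)) := hψs.comp_left Complex.ofReal_zero
  obtain ⟨K, hK0, hKb, hKd⟩ := fourier_decay hc hs 2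
  exact ⟨K, hK0, hKb, hKd⟩

/-- The majorant `s ↦ K` on `|s| ≤ 2`, `4K/s²` beyond, is integrable. [folklore] -/
theorem integrable_majorant (K : ℝ) :
    Integrable (fun s : ℝ ↦ if |s| ≤ 2 then K else 4 * K / s ^ 2) := by
  have h1 : Integrable (fun s : ℝ ↦ (Set.Icc (-2 : ℝ) 2).indicator (fun _ ↦ K) s) :=
    (continuous_const.integrableOn_Icc (a := (-2 : ℝ)) (b := 2)).integrable_indicator
      measurableSet_Icc
  have h2 : IntegrableOn (fun s : ℝ ↦ 4 * K / s ^ 2) (Set.Ioi (2 : ℝ)) := by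
    have h0 : IntegrableOn (fun s : ℝ ↦ 4 * K * s ^ (-2 : ℝ)) (Set.Ioi (2 : ℝ)) :=
      (integrableOn_Ioi_rpow_of_lt (by norm_num : (-2 : ℝ) < -1) two_pos).const_mul (4 * K)
    refine h0.congr_fun (fun s hs ↦ ?_) measurableSet_Ioi
    have hs0 : 0 < s := lt_trans two_pos hs
    simp only
    rw [Real.rpow_neg hs0.le, show (2 : ℝ) = (2 : ℕ) by norm_num, Real.rpow_natCast, div_eq_mul_inv]
  have h3 : IntegrableOn (fun s : ℝ ↦ 4 * K / s ^ 2) (Set.Iio (-2 : ℝ)) := by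
    have h2' := h2.comp_neg
    simp only [neg_sq] at h2'
    have : Set.Iio (-2 : ℝ) = -Set.Ioi (2 : ℝ) := by
      ext s
      simp only [Set.mem_Iio, Set.mem_neg, Set.mem_Ioi]
      constructor <;> intro h <;> linarith
    rw [this]
    exact h2'
  have h23 : IntegrableOn (fun s : ℝ ↦ 4 * K / s ^ 2) (Set.Iio (-2 : ℝ) ∪ Set.Ioi 2) := h3.union h2
  have h4 : Integrable (fun s : ℝ ↦ (Set.Iio (-2 : ℝ) ∪ Set.Ioi 2).indicator (fun s ↦ 4 * K / s ^ 2) s) :=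
    h23.integrable_indicator (measurableSet_Iio.union measurableSet_Ioi)
  refine (h1.add h4).congr (Eventually.of_forall fun s ↦ ?_)
  simp only [Pi.add_apply]
  by_cases hs : |s| ≤ 2
  · rw [if_pos hs, Set.indicator_of_mem (by rw [Set.mem_Icc]; exact abs_le.mp hs),
      Set.indicator_of_notMem, add_zero]
    simp only [Set.mem_union, Set.mem_Iio, Set.mem_Ioi, not_or, not_lt]
    exact ⟨by linarith [(abs_le.mp hs).1], (abs_le.mp hs).2⟩
  · rw [if_neg hs, Set.indicator_of_notMem, Set.indicator_of_mem, zero_add]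
    · simp only [Set.mem_union, Set.mem_Iio, Set.mem_Ioi]
      push Not at hs
      rcases lt_or_ge s 0 with h | h
      · left; rw [abs_of_neg h] at hs; linarith
      · right; rw [abs_of_nonneg h] at hs; linarith
    · rw [Set.mem_Icc]; intro h; exact hs (abs_le.mpr h)

/-- The Fourier transform of the complexified bump is integrable. [folklore] -/
theorem integrable_fourier_bump (hψ : ContDiff ℝ ∞ ψ) (hψs : HasCompactSupport ψ) :
    Integrable (𝓕 (fun x ↦ (ψ x : ℂ))) := by
  obtain ⟨K, hK0, hKb, hKd⟩ := exists_majorant_fourier_bump hψ hψs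
  have hi := integrable_ofReal_bump hψ hψs
  have hcont : Continuous (𝓕 (fun x ↦ (ψ x : ℂ))) :=
    VectorFourier.fourierIntegral_continuous Real.continuous_fourierChar
      (by exact continuous_inner) hi
  refine (integrable_majorant K).mono' hcont.aestronglyMeasurable (Eventually.of_forall fun ξ ↦ ?_)
  split_ifs with h
  · exact hKb ξ
  · push Not at h
    have hξ : ξ ≠ 0 := by intro h0; rw [h0, abs_zero] at h; linarith
    refine (hKd ξ hξ).trans ?_
    rw [← sq_abs ξ, div_le_div_iff₀ (by positivity) (by positivity)]
    nlinarith [abs_nonneg ξ]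

/-- Fourier inversion for the bump: `ψ(x) = ∫ e(vx) ψ̂(v) dv`. [folklore] -/
theorem bump_eq_integral (hψ : ContDiff ℝ ∞ ψ) (hψs : HasCompactSupport ψ) (x : ℝ) :
    ((ψ x : ℝ) : ℂ) = ∫ v, ((𝐞 (v * x) : ℂ)) * 𝓕 (fun y ↦ (ψ y : ℂ)) v := by
  have hc : Continuous (fun y ↦ (ψ y : ℂ)) := Complex.continuous_ofReal.comp hψ.continuous
  have h := congrFun (hc.fourierInv_fourier_eq (integrable_ofReal_bump hψ hψs)
    (integrable_fourier_bump hψ hψs)) x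
  rw [← h, Real.fourierInv_eq_fourier_neg, Real.fourier_real_eq]
  refine integral_congr_ae (Eventually.of_forall fun v ↦ ?_)
  simp only [Circle.smul_def, smul_eq_mul, mul_neg, neg_neg]

/-- **Guth–Maynard Lemma 11.3 (Dirichlet polynomials do not vary too fast), exact form.** Let `ψ`
be a smooth compactly supported bump with `ψ = 1` on `[0, log 2/(2π)]`. Then for `N ≥ 1`, any
coefficients `b_n` and real `t`,
`∑_{N≤n≤2N} b_n n^{it} = ∫ e(−v log N/2π) ψ̂(v) (∑_{N≤n≤2N} b_n n^{i(t+v)}) dv`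
("`D(t) = ∑_n b_n n^{it} ψ(log n/2π) = ∫ ψ̂(ξ)D(t−ξ)dξ`"; we use the bump translated by `log N/2π`,
which only changes `ψ̂` by a unimodular factor). [cite: GuthMaynard2026, Lemma 11.3] -/
theorem smoothing_identity (hψ : ContDiff ℝ ∞ ψ) (hψs : HasCompactSupport ψ)
    (hψ1 : ∀ x : ℝ, 0 ≤ x → x ≤ Real.log 2 / (2 * π) → ψ x = 1) {N : ℕ} (hN : 1 ≤ N)
    (b : ℕ → ℂ) (t : ℝ) :
    ∑ n ∈ Finset.Icc N (2 * N), b n * (n : ℂ) ^ ((t : ℂ) * I) =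
      ∫ v, (((𝐞 (-(v * (Real.log N / (2 * π))))) : ℂ) * 𝓕 (fun y ↦ (ψ y : ℂ)) v) *
        ∑ n ∈ Finset.Icc N (2 * N), b n * (n : ℂ) ^ ((((t + v : ℝ)) : ℂ) * I) := by
  have hN0 : (0 : ℝ) < N := by exact_mod_cast hN
  have hπ : (0 : ℝ) < 2 * π := by positivity
  set F : ℝ → ℂ := 𝓕 (fun y ↦ (ψ y : ℂ)) with hF
  have hFi : Integrable F := integrable_fourier_bump hψ hψs
  -- each term
  have hterm : ∀ n ∈ Finset.Icc N (2 * N), b n * (n : ℂ) ^ ((t : ℂ) * I) =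
      ∫ v, (((𝐞 (-(v * (Real.log N / (2 * π))))) : ℂ) * F v) *
        (b n * (n : ℂ) ^ ((((t + v : ℝ)) : ℂ) * I)) := by
    intro n hn
    rw [Finset.mem_Icc] at hn
    have hn0 : n ≠ 0 := by omega
    have hn0' : (0 : ℝ) < n := by exact_mod_cast Nat.pos_of_ne_zero hn0
    -- `1 = ψ(log n/2π − log N/2π) = ∫ e(v(log n/2π − log N/2π)) ψ̂(v) dv`
    set x : ℝ := Real.log n / (2 * π) - Real.log N / (2 * π) with hx
    have hx0 : 0 ≤ x := by
      rw [hx, ← sub_div]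
      exact div_nonneg (by rw [sub_nonneg]; exact Real.log_le_log hN0 (by exact_mod_cast hn.1)) hπ.le
    have hx1 : x ≤ Real.log 2 / (2 * π) := by
      rw [hx, ← sub_div]
      refine div_le_div_of_nonneg_right ?_ hπ.le
      rw [sub_le_iff_le_add, ← Real.log_mul two_pos.ne' hN0.ne']
      exact Real.log_le_log hn0' (by exact_mod_cast hn.2)
    have h1 : (1 : ℂ) = ∫ v, ((𝐞 (v * x) : ℂ)) * F v := by
      rw [← bump_eq_integral hψ hψs x, hψ1 x hx0 hx1]; simp
    have h2 : ∀ v : ℝ, ((𝐞 (v * x) : ℂ)) =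
        (n : ℂ) ^ ((v : ℂ) * I) * ((𝐞 (-(v * (Real.log N / (2 * π))))) : ℂ) := by
      intro v
      rw [← fourierChar_mul_log n hn0 v, ← Circle.coe_mul, ← AddChar.map_add_eq_mul]
      congr 2; rw [hx]; ring
    calc b n * (n : ℂ) ^ ((t : ℂ) * I) = b n * (n : ℂ) ^ ((t : ℂ) * I) * 1 := by ring
      _ = b n * (n : ℂ) ^ ((t : ℂ) * I) * ∫ v, ((𝐞 (v * x) : ℂ)) * F v := by rw [← h1]
      _ = ∫ v, b n * (n : ℂ) ^ ((t : ℂ) * I) * (((𝐞 (v * x) : ℂ)) * F v) := by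
          rw [← integral_const_mul]
      _ = _ := by
          refine integral_congr_ae (Eventually.of_forall fun v ↦ ?_)
          simp only
          rw [h2 v, ← natCast_cpow_mul_I_add n hn0 t v]
          ring
  -- sum up
  rw [Finset.sum_congr rfl hterm, ← integral_finsetSum]
  · refine integral_congr_ae (Eventually.of_forall fun v ↦ ?_)
    simp only [Finset.mul_sum]
  · intro n hn
    have : (fun v : ℝ ↦ (((𝐞 (-(v * (Real.log N / (2 * π))))) : ℂ) * F v) *
        (b n * (n : ℂ) ^ ((((t + v : ℝ)) : ℂ) * I))) =
        fun v : ℝ ↦ F v * ((((𝐞 (-(v * (Real.log N / (2 * π))))) : ℂ)) *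
          (b n * (n : ℂ) ^ ((((t + v : ℝ)) : ℂ) * I))) := by
      ext v; ring
    rw [this]
    rw [Finset.mem_Icc] at hn
    have hn0 : n ≠ 0 := by omega
    have hcpow : (fun v : ℝ ↦ (n : ℂ) ^ ((((t + v : ℝ)) : ℂ) * I)) =
        fun v : ℝ ↦ Complex.exp (Complex.log n * ((((t + v : ℝ)) : ℂ) * I)) := by
      ext v; rw [Complex.cpow_def_of_ne_zero (by exact_mod_cast hn0)]
    refine hFi.mul_bdd (c := ‖b n‖) (Continuous.aestronglyMeasurable ?_)
      (Eventually.of_forall fun v ↦ ?_)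
    · refine Continuous.mul ?_ (continuous_const.mul ?_)
      · simp only [Real.fourierChar_apply]
        fun_prop
      · rw [hcpow]; fun_prop
    · rw [norm_mul, norm_mul, Circle.norm_coe, one_mul,
        Complex.norm_natCast_cpow_of_pos (Nat.pos_of_ne_zero hn0)]
      simp

/-- **Lemma 11.3, the bound**: with `k = |ψ̂|` and `A = max(1, ∫k)`,
`|D(t)|² ≤ A ∫ k(v)|D(t+v)|² dv` for `D(t) = ∑_{N≤n≤2N} b_n n^{it}` ("`|D(t)| ≪ ∫_{|u−t|⪅1}|D(u)|du`"
and Cauchy–Schwarz, as used in the proof of Lemma 11.4). [cite: GuthMaynard2026, Lemmas 11.3–11.4] -/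
theorem smoothing_bound (hψ : ContDiff ℝ ∞ ψ) (hψs : HasCompactSupport ψ)
    (hψ1 : ∀ x : ℝ, 0 ≤ x → x ≤ Real.log 2 / (2 * π) → ψ x = 1) {N : ℕ} (hN : 1 ≤ N)
    (b : ℕ → ℂ) (t : ℝ) :
    ‖∑ n ∈ Finset.Icc N (2 * N), b n * (n : ℂ) ^ ((t : ℂ) * I)‖ ^ 2 ≤
      max 1 (∫ v, ‖𝓕 (fun y ↦ (ψ y : ℂ)) v‖) *
        ∫ v, ‖𝓕 (fun y ↦ (ψ y : ℂ)) v‖ *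
          ‖∑ n ∈ Finset.Icc N (2 * N), b n * (n : ℂ) ^ ((((t + v : ℝ)) : ℂ) * I)‖ ^ 2 := by
  set F : ℝ → ℂ := 𝓕 (fun y ↦ (ψ y : ℂ)) with hF
  set D : ℝ → ℂ := fun τ ↦ ∑ n ∈ Finset.Icc N (2 * N), b n * (n : ℂ) ^ ((τ : ℂ) * I) with hD
  have hFi : Integrable F := integrable_fourier_bump hψ hψs
  set A : ℝ := max 1 (∫ v, ‖F v‖) with hA
  have hA1 : 1 ≤ A := le_max_left _ _
  have hA0 : 0 < A := by linarith
  have hK₁ : ∫ v, ‖F v‖ ≤ A := le_max_right _ _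
  -- `D` is bounded and continuous
  set B : ℝ := ∑ n ∈ Finset.Icc N (2 * N), ‖b n‖ with hB
  have hDle : ∀ τ : ℝ, ‖D τ‖ ≤ B := by
    intro τ
    refine (norm_sum_le _ _).trans (Finset.sum_le_sum fun n hn ↦ ?_)
    rw [Finset.mem_Icc] at hn
    rw [norm_mul, Complex.norm_natCast_cpow_of_pos (by omega)]
    simp
  have hDcont : Continuous D := by
    refine continuous_finsetSum _ fun n hn ↦ ?_
    rw [Finset.mem_Icc] at hn
    have : (fun τ : ℝ ↦ b n * (n : ℂ) ^ ((τ : ℂ) * I)) =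
        fun τ : ℝ ↦ b n * Complex.exp (Complex.log n * ((τ : ℂ) * I)) := by
      ext τ; rw [Complex.cpow_def_of_ne_zero (by exact_mod_cast (show n ≠ 0 by omega))]
    rw [this]; fun_prop
  have hDt : ∀ v : ℝ, D (t + v) = ∑ n ∈ Finset.Icc N (2 * N), b n * (n : ℂ) ^ ((((t + v : ℝ)) : ℂ) * I) :=
    fun v ↦ rfl
  -- integrability of the weights
  have hI1 : Integrable (fun v ↦ ‖F v‖ * ‖D (t + v)‖) :=
    hFi.norm.mul_bdd (c := B) ((hDcont.comp (continuous_const_add t)).norm.aestronglyMeasurable)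
      (Eventually.of_forall fun v ↦ by rw [Real.norm_eq_abs, abs_norm]; exact hDle _)
  have hI2 : Integrable (fun v ↦ ‖F v‖ * ‖D (t + v)‖ ^ 2) :=
    hFi.norm.mul_bdd (c := B ^ 2) (((hDcont.comp (continuous_const_add t)).norm.pow 2).aestronglyMeasurable)
      (Eventually.of_forall fun v ↦ by
        rw [Real.norm_eq_abs, abs_of_nonneg (sq_nonneg _)]
        exact pow_le_pow_left₀ (norm_nonneg _) (hDle _) 2)
  -- Step 1: `|D t| ≤ ∫ k |D(t+v)|`
  have h1 : ‖D t‖ ≤ ∫ v, ‖F v‖ * ‖D (t + v)‖ := by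
    have hid := smoothing_identity hψ hψs hψ1 hN b t
    change D t = ∫ v, (((𝐞 (-(v * (Real.log N / (2 * π))))) : ℂ) * F v) * D (t + v) at hid
    rw [hid]
    refine (norm_integral_le_integral_norm _).trans (le_of_eq ?_)
    refine integral_congr_ae (Eventually.of_forall fun v ↦ ?_)
    simp only [norm_mul, Circle.norm_coe, one_mul]
  -- Step 2: AM–GM inside the integral
  set a : ℝ := ‖D t‖ with ha
  have ha0 : 0 ≤ a := norm_nonneg _
  set J : ℝ := ∫ v, ‖F v‖ * ‖D (t + v)‖ ^ 2 with hJ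
  have hJ0 : 0 ≤ J := integral_nonneg fun v ↦ by positivity
  have h2 : a * ∫ v, ‖F v‖ * ‖D (t + v)‖ ≤ A / 2 * J + a ^ 2 / (2 * A) * ∫ v, ‖F v‖ := by
    rw [← integral_const_mul, ← integral_const_mul, ← integral_const_mul, ← integral_add]
    · refine integral_mono (hI1.const_mul a) ((hI2.const_mul _).add (hFi.norm.const_mul _))
        fun v ↦ ?_
      simp only
      have hk : 0 ≤ ‖F v‖ := norm_nonneg _
      have hx : 0 ≤ ‖D (t + v)‖ := norm_nonneg _
      have key : a * ‖D (t + v)‖ ≤ A / 2 * ‖D (t + v)‖ ^ 2 + a ^ 2 / (2 * A) := by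
        rw [← sub_nonneg]
        have : A / 2 * ‖D (t + v)‖ ^ 2 + a ^ 2 / (2 * A) - a * ‖D (t + v)‖ =
            (A * ‖D (t + v)‖ - a) ^ 2 / (2 * A) := by
          field_simp; ring
        rw [this]; positivity
      nlinarith [mul_le_mul_of_nonneg_left key hk]
    · exact hI2.const_mul _
    · exact hFi.norm.const_mul _
  -- conclude
  have h3 : a ^ 2 ≤ A / 2 * J + a ^ 2 / 2 := by
    calc a ^ 2 = a * a := by ring
      _ ≤ a * ∫ v, ‖F v‖ * ‖D (t + v)‖ := mul_le_mul_of_nonneg_left h1 ha0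
      _ ≤ A / 2 * J + a ^ 2 / (2 * A) * ∫ v, ‖F v‖ := h2
      _ ≤ A / 2 * J + a ^ 2 / (2 * A) * A := by gcongr
      _ = A / 2 * J + a ^ 2 / 2 := by field_simp
  change a ^ 2 ≤ A * J
  nlinarith [h3]

/-! ## §2. Energy controlled by the discrete third moment (Guth–Maynard Lemma 11.4) -/

/-- In a `1`-separated set at most `3` points lie within distance `1` of a given real. [folklore] -/
theorem card_near_le_three (W : Finset ℝ) (hsep : ∀ t ∈ W, ∀ t' ∈ W, t ≠ t' → 1 ≤ |t - t'|)
    (τ : ℝ) : ((W.filter fun t ↦ |τ - t| ≤ 1).card : ℝ) ≤ 3 := by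
  classical
  set W' := (W.filter fun t ↦ |τ - t| ≤ 1).image (fun t ↦ t - (τ - 1)) with hW'
  have hinj : Function.Injective (fun t : ℝ ↦ t - (τ - 1)) := sub_left_injective
  have hcard : W'.card = (W.filter fun t ↦ |τ - t| ≤ 1).card := Finset.card_image_of_injective _ hinj
  have h := GuthMaynardReduction.card_le_of_one_sep (T := 2) (by norm_num) W' ?_ ?_
  · rw [hcard] at h; linarith
  · intro u hu
    rw [hW', Finset.mem_image] at hu
    obtain ⟨t, ht, rfl⟩ := hu
    rw [Finset.mem_filter] at ht
    have := abs_le.mp ht.2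
    constructor <;> linarith [this.1, this.2]
  · intro u hu u' hu' hne
    rw [hW', Finset.mem_image] at hu hu'
    obtain ⟨t, ht, rfl⟩ := hu
    obtain ⟨t', ht', rfl⟩ := hu'
    have hne' : t ≠ t' := fun h ↦ hne (by rw [h])
    rw [show t - (τ - 1) - (t' - (τ - 1)) = t - t' by ring]
    exact hsep t (Finset.mem_filter.mp ht).1 t' (Finset.mem_filter.mp ht').1 hne'

/-- The translated kernel is dominated by the majorant: if `|k(ξ)| ≤ K` and `|k(ξ)| ≤ K/ξ²` then
`k(s + x) ≤ g(s)` for `|x| ≤ 1`, `g(s) = K (|s| ≤ 2), 4K/s² (|s| > 2)`. [folklore] -/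
theorem kernel_shift_le {k : ℝ → ℝ} {K : ℝ} (hK0 : 0 ≤ K) (hkb : ∀ ξ, k ξ ≤ K)
    (hkd : ∀ ξ, ξ ≠ 0 → k ξ ≤ K / |ξ| ^ 2) {x : ℝ} (hx : |x| ≤ 1) (s : ℝ) :
    k (s + x) ≤ if |s| ≤ 2 then K else 4 * K / s ^ 2 := by
  split_ifs with hs
  · exact hkb _
  · push Not at hs
    have h1 : |s| / 2 ≤ |s + x| := by
      have := abs_add_le (s + x) (-x)  -- |s| ≤ |s+x| + |x|
      rw [add_neg_cancel_right, abs_neg] at this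
      linarith
    have h2 : 0 < |s + x| := by linarith
    have hsx : s + x ≠ 0 := abs_pos.mp h2
    refine (hkd _ hsx).trans ?_
    have hs0 : 0 < |s| := by linarith
    have hs2 : 0 < s ^ 2 := by rw [← sq_abs]; positivity
    rw [div_le_div_iff₀ (by positivity) hs2, ← sq_abs s]
    have h3 := mul_self_le_mul_self (by positivity : 0 ≤ |s| / 2) h1
    nlinarith [mul_le_mul_of_nonneg_left h3 hK0]

end bump

/-- `∑_{t₁,t₂,t₃} f(t₁) g(t₂) h(t₃) = (∑f)(∑g)(∑h)`. [folklore] -/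
theorem sum_mul_mul_eq {α : Type*} (s : Finset α) (f g h : α → ℂ) :
    ∑ t₁ ∈ s, ∑ t₂ ∈ s, ∑ t₃ ∈ s, f t₁ * g t₂ * h t₃ =
      (∑ t ∈ s, f t) * (∑ t ∈ s, g t) * (∑ t ∈ s, h t) := by
  rw [Finset.sum_mul_sum, Finset.sum_mul]
  refine Finset.sum_congr rfl fun t₁ _ ↦ ?_
  rw [Finset.sum_mul]
  refine Finset.sum_congr rfl fun t₂ _ ↦ ?_
  rw [Finset.mul_sum]

/-- The phase identity behind Lemma 11.4: for `n₁, n₂ ≥ 1` and `u(t) = n₁^{it} n₂^{-it}`,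
`n₁^{iτ} conj(n₂^{iτ}) = u(t₁)u(t₂) conj(u(t₃)) u(s)` for `τ = t₁ + t₂ − t₃ + s`. [folklore] -/
theorem phase_identity {n₁ n₂ : ℕ} (h₁ : n₁ ≠ 0) (h₂ : n₂ ≠ 0) (t₁ t₂ t₃ s : ℝ) :
    (n₁ : ℂ) ^ ((((t₁ + t₂ - t₃ + s : ℝ)) : ℂ) * I) *
        (starRingEnd ℂ) ((n₂ : ℂ) ^ ((((t₁ + t₂ - t₃ + s : ℝ)) : ℂ) * I)) =
      ((n₁ : ℂ) ^ ((t₁ : ℂ) * I) * (n₂ : ℂ) ^ (-((t₁ : ℂ) * I))) *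
        ((n₁ : ℂ) ^ ((t₂ : ℂ) * I) * (n₂ : ℂ) ^ (-((t₂ : ℂ) * I))) *
        (starRingEnd ℂ) ((n₁ : ℂ) ^ ((t₃ : ℂ) * I) * (n₂ : ℂ) ^ (-((t₃ : ℂ) * I))) *
        ((n₁ : ℂ) ^ ((s : ℂ) * I) * (n₂ : ℂ) ^ (-((s : ℂ) * I))) := by
  have hn₁ : (n₁ : ℂ) ≠ 0 := by exact_mod_cast h₁
  have hn₂ : (n₂ : ℂ) ≠ 0 := by exact_mod_cast h₂
  rw [map_mul, DoubleZetaSum.conj_natCast_cpow, DoubleZetaSum.conj_natCast_cpow,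
    DoubleZetaSum.conj_natCast_cpow, map_neg, DoubleZetaSum.conj_ofReal_mul_I,
    DoubleZetaSum.conj_ofReal_mul_I, neg_neg]
  have e₁ : (((t₁ + t₂ - t₃ + s : ℝ)) : ℂ) * I =
      (t₁ : ℂ) * I + (t₂ : ℂ) * I + (-((t₃ : ℂ) * I)) + (s : ℂ) * I := by push_cast; ring
  have e₂ : -((((t₁ + t₂ - t₃ + s : ℝ)) : ℂ) * I) =
      (-((t₁ : ℂ) * I)) + (-((t₂ : ℂ) * I)) + (t₃ : ℂ) * I + (-((s : ℂ) * I)) := by push_cast; ring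
  rw [e₂, e₁]
  simp only [Complex.cpow_add _ _ hn₁, Complex.cpow_add _ _ hn₂]
  ring

/-- Reordering `∑_{t₁,t₂,t₃ ∈ W} ∑_{n₁,n₂ ∈ S} = ∑_{n₁,n₂ ∈ S} ∑_{t₁,t₂,t₃ ∈ W}`. [folklore] -/
theorem sum_comm_three_two {α β : Type*} (W : Finset α) (S : Finset β)
    (f : α → α → α → β → β → ℂ) :
    ∑ t₁ ∈ W, ∑ t₂ ∈ W, ∑ t₃ ∈ W, ∑ n₁ ∈ S, ∑ n₂ ∈ S, f t₁ t₂ t₃ n₁ n₂ =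
      ∑ n₁ ∈ S, ∑ n₂ ∈ S, ∑ t₁ ∈ W, ∑ t₂ ∈ W, ∑ t₃ ∈ W, f t₁ t₂ t₃ n₁ n₂ := by
  calc ∑ t₁ ∈ W, ∑ t₂ ∈ W, ∑ t₃ ∈ W, ∑ n₁ ∈ S, ∑ n₂ ∈ S, f t₁ t₂ t₃ n₁ n₂
      = ∑ t₁ ∈ W, ∑ t₂ ∈ W, ∑ n₁ ∈ S, ∑ t₃ ∈ W, ∑ n₂ ∈ S, f t₁ t₂ t₃ n₁ n₂ :=
        Finset.sum_congr rfl fun _ _ ↦ Finset.sum_congr rfl fun _ _ ↦ Finset.sum_comm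
    _ = ∑ t₁ ∈ W, ∑ n₁ ∈ S, ∑ t₂ ∈ W, ∑ t₃ ∈ W, ∑ n₂ ∈ S, f t₁ t₂ t₃ n₁ n₂ :=
        Finset.sum_congr rfl fun _ _ ↦ Finset.sum_comm
    _ = ∑ n₁ ∈ S, ∑ t₁ ∈ W, ∑ t₂ ∈ W, ∑ t₃ ∈ W, ∑ n₂ ∈ S, f t₁ t₂ t₃ n₁ n₂ := Finset.sum_comm
    _ = ∑ n₁ ∈ S, ∑ t₁ ∈ W, ∑ t₂ ∈ W, ∑ n₂ ∈ S, ∑ t₃ ∈ W, f t₁ t₂ t₃ n₁ n₂ :=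
        Finset.sum_congr rfl fun _ _ ↦ Finset.sum_congr rfl fun _ _ ↦
          Finset.sum_congr rfl fun _ _ ↦ Finset.sum_comm
    _ = ∑ n₁ ∈ S, ∑ t₁ ∈ W, ∑ n₂ ∈ S, ∑ t₂ ∈ W, ∑ t₃ ∈ W, f t₁ t₂ t₃ n₁ n₂ :=
        Finset.sum_congr rfl fun _ _ ↦ Finset.sum_congr rfl fun _ _ ↦ Finset.sum_comm
    _ = ∑ n₁ ∈ S, ∑ n₂ ∈ S, ∑ t₁ ∈ W, ∑ t₂ ∈ W, ∑ t₃ ∈ W, f t₁ t₂ t₃ n₁ n₂ :=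
        Finset.sum_congr rfl fun _ _ ↦ Finset.sum_comm

/-- **The cubic `R`-bound** (the last display in the proof of Lemma 11.4): for `1`-bounded `b_n`,
`∑_{t₁,t₂,t₃∈W} |D(t₁+t₂−t₃+s)|² = ∑_{n₁,n₂} b_{n₁} b̄_{n₂} (n₁/n₂)^{is} R(n₁/n₂)² R̄(n₁/n₂)`, so
`∑_{t₁,t₂,t₃∈W} |D(t₁+t₂−t₃+s)|² ≤ ∑_{n₁,n₂ ∈ [N,2N]} |R(n₁/n₂)|³`.
[cite: GuthMaynard2026, proof of Lemma 11.4] -/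
theorem triple_sum_normSq_le (N : ℕ) (hN : 1 ≤ N) (b : ℕ → ℂ) (hb : ∀ n, ‖b n‖ ≤ 1)
    (W : Finset ℝ) (s : ℝ) :
    ∑ t₁ ∈ W, ∑ t₂ ∈ W, ∑ t₃ ∈ W,
      ‖∑ n ∈ Finset.Icc N (2 * N), b n * (n : ℂ) ^ ((((t₁ + t₂ - t₃ + s : ℝ)) : ℂ) * I)‖ ^ 2 ≤
      ∑ n₁ ∈ Finset.Icc N (2 * N), ∑ n₂ ∈ Finset.Icc N (2 * N),
        ‖Rfun W ((n₁ : ℝ) / n₂)‖ ^ 3 := by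
  set S := Finset.Icc N (2 * N) with hS
  have hS0 : ∀ n ∈ S, n ≠ 0 := fun n hn ↦ by rw [hS, Finset.mem_Icc] at hn; omega
  -- the complex identity
  set u : ℕ → ℕ → ℝ → ℂ := fun n₁ n₂ t ↦ (n₁ : ℂ) ^ ((t : ℂ) * I) * (n₂ : ℂ) ^ (-((t : ℂ) * I))
    with hu
  have hnorm : ∀ n₁ ∈ S, ∀ n₂ ∈ S, ∀ t : ℝ, ‖u n₁ n₂ t‖ = 1 := by
    intro n₁ h₁ n₂ h₂ t
    rw [hu]; simp only
    rw [norm_mul, Complex.norm_natCast_cpow_of_pos (Nat.pos_of_ne_zero (hS0 n₁ h₁)),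
      Complex.norm_natCast_cpow_of_pos (Nat.pos_of_ne_zero (hS0 n₂ h₂))]
    simp
  have hR : ∀ n₁ ∈ S, ∀ n₂ ∈ S, ∑ t ∈ W, u n₁ n₂ t = Rfun W ((n₁ : ℝ) / n₂) := by
    intro n₁ h₁ n₂ h₂
    rw [Rfun_natCast_div W (hS0 n₁ h₁) (hS0 n₂ h₂)]
  have hsq : ∀ τ : ℝ, (((‖∑ n ∈ S, b n * (n : ℂ) ^ ((τ : ℂ) * I)‖ ^ 2 : ℝ)) : ℂ) =
      ∑ n₁ ∈ S, ∑ n₂ ∈ S, b n₁ * (starRingEnd ℂ) (b n₂) *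
        ((n₁ : ℂ) ^ ((τ : ℂ) * I) * (starRingEnd ℂ) ((n₂ : ℂ) ^ ((τ : ℂ) * I))) := by
    intro τ
    rw [Complex.ofReal_pow, ← Complex.mul_conj', map_sum, Finset.sum_mul_sum]
    refine Finset.sum_congr rfl fun n₁ _ ↦ Finset.sum_congr rfl fun n₂ _ ↦ ?_
    rw [map_mul]; ring
  have hident : (((∑ t₁ ∈ W, ∑ t₂ ∈ W, ∑ t₃ ∈ W,
      ‖∑ n ∈ S, b n * (n : ℂ) ^ ((((t₁ + t₂ - t₃ + s : ℝ)) : ℂ) * I)‖ ^ 2 : ℝ)) : ℂ) =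
      ∑ n₁ ∈ S, ∑ n₂ ∈ S, b n₁ * (starRingEnd ℂ) (b n₂) *
        (u n₁ n₂ s * ((∑ t ∈ W, u n₁ n₂ t) * (∑ t ∈ W, u n₁ n₂ t) *
          (∑ t ∈ W, (starRingEnd ℂ) (u n₁ n₂ t)))) := by
    simp only [Complex.ofReal_sum, hsq]
    rw [sum_comm_three_two W S]
    refine Finset.sum_congr rfl fun n₁ h₁ ↦ Finset.sum_congr rfl fun n₂ h₂ ↦ ?_
    have hph : ∀ t₁ t₂ t₃ : ℝ, b n₁ * (starRingEnd ℂ) (b n₂) *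
        ((n₁ : ℂ) ^ ((((t₁ + t₂ - t₃ + s : ℝ)) : ℂ) * I) *
          (starRingEnd ℂ) ((n₂ : ℂ) ^ ((((t₁ + t₂ - t₃ + s : ℝ)) : ℂ) * I))) =
        b n₁ * (starRingEnd ℂ) (b n₂) * u n₁ n₂ s *
          (u n₁ n₂ t₁ * u n₁ n₂ t₂ * (starRingEnd ℂ) (u n₁ n₂ t₃)) := by
      intro t₁ t₂ t₃
      rw [phase_identity (hS0 n₁ h₁) (hS0 n₂ h₂)]
      simp only [hu]; ring
    simp_rw [hph]
    rw [show (∑ t₁ ∈ W, ∑ t₂ ∈ W, ∑ t₃ ∈ W, b n₁ * (starRingEnd ℂ) (b n₂) * u n₁ n₂ s *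
        (u n₁ n₂ t₁ * u n₁ n₂ t₂ * (starRingEnd ℂ) (u n₁ n₂ t₃))) =
        b n₁ * (starRingEnd ℂ) (b n₂) * u n₁ n₂ s * ((∑ t ∈ W, u n₁ n₂ t) * (∑ t ∈ W, u n₁ n₂ t) *
          (∑ t ∈ W, (starRingEnd ℂ) (u n₁ n₂ t))) from by
      rw [← sum_mul_mul_eq]; simp only [Finset.mul_sum]]
    ring
  -- take norms
  have hreal : ∑ t₁ ∈ W, ∑ t₂ ∈ W, ∑ t₃ ∈ W,
      ‖∑ n ∈ S, b n * (n : ℂ) ^ ((((t₁ + t₂ - t₃ + s : ℝ)) : ℂ) * I)‖ ^ 2 =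
      (∑ n₁ ∈ S, ∑ n₂ ∈ S, b n₁ * (starRingEnd ℂ) (b n₂) *
        (u n₁ n₂ s * ((∑ t ∈ W, u n₁ n₂ t) * (∑ t ∈ W, u n₁ n₂ t) *
          (∑ t ∈ W, (starRingEnd ℂ) (u n₁ n₂ t))))).re := by
    rw [← hident, Complex.ofReal_re]
  rw [hreal]
  refine (Complex.re_le_norm _).trans ((norm_sum_le _ _).trans (Finset.sum_le_sum fun n₁ h₁ ↦
    (norm_sum_le _ _).trans (Finset.sum_le_sum fun n₂ h₂ ↦ ?_)))
  rw [← map_sum, hR n₁ h₁ n₂ h₂]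
  have hb1 := hb n₁; have hb2 := hb n₂
  have hus := hnorm n₁ h₁ n₂ h₂ s
  generalize u n₁ n₂ s = w at hus ⊢
  generalize Rfun W ((n₁ : ℝ) / n₂) = R
  have hR0 : 0 ≤ ‖R‖ := norm_nonneg _
  calc ‖b n₁ * (starRingEnd ℂ) (b n₂) * (w * (R * R * (starRingEnd ℂ) R))‖
      = ‖b n₁‖ * ‖b n₂‖ * (‖w‖ * (‖R‖ * ‖R‖ * ‖R‖)) := by
        simp only [norm_mul, Complex.norm_conj]
    _ ≤ 1 * 1 * (1 * (‖R‖ * ‖R‖ * ‖R‖)) := by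
        rw [hus]
        gcongr
    _ = ‖R‖ ^ 3 := by ring

section bump

variable {ψ : ℝ → ℝ}

set_option maxHeartbeats 1000000 in
/-- **Guth–Maynard Lemma 11.4 (Energy controlled by the discrete third moment).** Let `ψ` be a
smooth compactly supported bump with `ψ = 1` on `[0, log 2/(2π)]`. There is `C = C(ψ)` such that for
all `N ≥ 1`, real `σ`, `1`-bounded `b_n` and finite `1`-separated `W ⊂ ℝ` with
`|D(t)| = |∑_{N≤n≤2N} b_n n^{it}| ≥ N^σ` on `W`,
`E(W) = #{(t₁,t₂,t₃,t₄) ∈ W⁴ : |t₁+t₂−t₃−t₄| ≤ 1} ≤ C N^{-2σ} ∑_{n₁,n₂ ∈ [N,2N]} |R(n₁/n₂)|³`.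
Proof as in the paper: `E(W) ≤ N^{-2σ} ∑ |D(t₄)|²`, Lemma 11.3 and Cauchy–Schwarz
(`smoothing_bound`), at most `3` choices of `t₄` given `t₁,t₂,t₃` (`card_near_le_three`), and the
cubic `R`-bound (`triple_sum_normSq_le`); here with no `T^{o(1)}`-loss since the smoothing weight is
kept inside the integral. [cite: GuthMaynard2026, Lemma 11.4] -/
theorem energy_le_third_moment (hψ : ContDiff ℝ ∞ ψ) (hψs : HasCompactSupport ψ)
    (hψ1 : ∀ x : ℝ, 0 ≤ x → x ≤ Real.log 2 / (2 * π) → ψ x = 1) :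
    ∃ C, 0 ≤ C ∧ ∀ (N : ℕ), 1 ≤ N → ∀ (σ : ℝ) (b : ℕ → ℂ) (W : Finset ℝ), (∀ n, ‖b n‖ ≤ 1) →
      (∀ t ∈ W, ∀ t' ∈ W, t ≠ t' → 1 ≤ |t - t'|) →
      (∀ t ∈ W, (N : ℝ) ^ σ ≤ ‖∑ n ∈ Finset.Icc N (2 * N), b n * (n : ℂ) ^ ((t : ℂ) * I)‖) →
      ((((W ×ˢ W) ×ˢ (W ×ˢ W)).filter
          (fun q : (ℝ × ℝ) × (ℝ × ℝ) ↦ |q.1.1 + q.1.2 - q.2.1 - q.2.2| ≤ 1)).card : ℝ) ≤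
        C * (N : ℝ) ^ (-2 * σ) * ∑ n₁ ∈ Finset.Icc N (2 * N), ∑ n₂ ∈ Finset.Icc N (2 * N),
          ‖Rfun W ((n₁ : ℝ) / n₂)‖ ^ 3 := by
  obtain ⟨K, hK0, hKb, hKd⟩ := exists_majorant_fourier_bump hψ hψs
  set F : ℝ → ℂ := 𝓕 (fun y ↦ (ψ y : ℂ)) with hF
  have hFi : Integrable F := integrable_fourier_bump hψ hψs
  set A : ℝ := max 1 (∫ v, ‖F v‖) with hA
  have hA0 : 0 ≤ A := le_trans zero_le_one (le_max_left _ _)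
  set g : ℝ → ℝ := fun s ↦ if |s| ≤ 2 then K else 4 * K / s ^ 2 with hg
  have hgi : Integrable g := integrable_majorant K
  have hg0 : ∀ s, 0 ≤ g s := fun s ↦ by
    simp only [hg]; split_ifs <;> positivity
  set G₀ : ℝ := ∫ s, g s with hG₀
  have hG₀0 : 0 ≤ G₀ := integral_nonneg hg0
  refine ⟨3 * A * G₀, by positivity, fun N hN σ b W hb hsep hlarge ↦ ?_⟩
  classical
  have hN0 : (0 : ℝ) < N := by exact_mod_cast hN
  set S := Finset.Icc N (2 * N) with hS
  set D : ℝ → ℂ := fun τ ↦ ∑ n ∈ S, b n * (n : ℂ) ^ ((τ : ℂ) * I) with hD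
  set M₃ : ℝ := ∑ n₁ ∈ S, ∑ n₂ ∈ S, ‖Rfun W ((n₁ : ℝ) / n₂)‖ ^ 3 with hM₃
  have hM₃0 : 0 ≤ M₃ := by positivity
  -- `D` is bounded and continuous
  set B : ℝ := ∑ n ∈ S, ‖b n‖ with hB
  have hDle : ∀ τ : ℝ, ‖D τ‖ ≤ B := by
    intro τ
    refine (norm_sum_le _ _).trans (Finset.sum_le_sum fun n hn ↦ ?_)
    rw [hS, Finset.mem_Icc] at hn
    rw [norm_mul, Complex.norm_natCast_cpow_of_pos (by omega)]
    simp
  have hDcont : Continuous D := by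
    refine continuous_finsetSum _ fun n hn ↦ ?_
    rw [hS, Finset.mem_Icc] at hn
    have : (fun τ : ℝ ↦ b n * (n : ℂ) ^ ((τ : ℂ) * I)) =
        fun τ : ℝ ↦ b n * Complex.exp (Complex.log n * ((τ : ℂ) * I)) := by
      ext τ; rw [Complex.cpow_def_of_ne_zero (by exact_mod_cast (show n ≠ 0 by omega))]
    rw [this]; fun_prop
  have hIF : ∀ t₄ : ℝ, Integrable (fun v ↦ ‖F v‖ * ‖D (t₄ + v)‖ ^ 2) := fun t₄ ↦
    hFi.norm.mul_bdd (c := B ^ 2)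
      (((hDcont.comp (continuous_const_add t₄)).norm.pow 2).aestronglyMeasurable)
      (Eventually.of_forall fun v ↦ by
        rw [Real.norm_eq_abs, abs_of_nonneg (sq_nonneg _)]
        exact pow_le_pow_left₀ (norm_nonneg _) (hDle _) 2)
  have hIg : ∀ τ : ℝ, Integrable (fun s ↦ g s * ‖D (τ + s)‖ ^ 2) := fun τ ↦
    hgi.mul_bdd (c := B ^ 2)
      (((hDcont.comp (continuous_const_add τ)).norm.pow 2).aestronglyMeasurable)
      (Eventually.of_forall fun v ↦ by
        rw [Real.norm_eq_abs, abs_of_nonneg (sq_nonneg _)]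
        exact pow_le_pow_left₀ (norm_nonneg _) (hDle _) 2)
  -- the smoothed majorant `Gτ`
  set Gτ : ℝ → ℝ := fun τ ↦ A * ∫ s, g s * ‖D (τ + s)‖ ^ 2 with hGτ
  have hGτ0 : ∀ τ, 0 ≤ Gτ τ := fun τ ↦
    mul_nonneg hA0 (integral_nonneg fun s ↦ by positivity)
  -- Step a: `|D(t₄)|² ≤ Gτ(τ)` whenever `|τ − t₄| ≤ 1`
  have hstepA : ∀ τ t₄ : ℝ, |τ - t₄| ≤ 1 → ‖D t₄‖ ^ 2 ≤ Gτ τ := by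
    intro τ t₄ hx
    have h1 := smoothing_bound hψ hψs hψ1 hN b t₄
    change ‖D t₄‖ ^ 2 ≤ A * ∫ v, ‖F v‖ * ‖D (t₄ + v)‖ ^ 2 at h1
    refine h1.trans (mul_le_mul_of_nonneg_left ?_ hA0)
    set x : ℝ := τ - t₄ with hxdef
    rw [← integral_add_right_eq_self (fun v ↦ ‖F v‖ * ‖D (t₄ + v)‖ ^ 2) x]
    refine integral_mono ((hIF t₄).comp_add_right x) (hIg τ) fun v ↦ ?_
    simp only
    have h2 : t₄ + (v + x) = τ + v := by rw [hxdef]; ring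
    rw [h2]
    exact mul_le_mul_of_nonneg_right
      (kernel_shift_le (k := fun ξ ↦ ‖F ξ‖) hK0 hKb hKd hx v) (sq_nonneg _)
  -- Step b
  set good := ((W ×ˢ W) ×ˢ (W ×ˢ W)).filter
    (fun q : (ℝ × ℝ) × (ℝ × ℝ) ↦ |q.1.1 + q.1.2 - q.2.1 - q.2.2| ≤ 1) with hgood
  have hstepB : (good.card : ℝ) * (N : ℝ) ^ (2 * σ) ≤
      ∑ q ∈ good, Gτ (q.1.1 + q.1.2 - q.2.1) := by
    rw [← nsmul_eq_mul, ← Finset.sum_const]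
    refine Finset.sum_le_sum fun q hq ↦ ?_
    rw [hgood, Finset.mem_filter, Finset.mem_product, Finset.mem_product, Finset.mem_product] at hq
    obtain ⟨⟨⟨h11, h12⟩, h21, h22⟩, hq⟩ := hq
    have hl := hlarge q.2.2 h22
    have h1 : (N : ℝ) ^ (2 * σ) ≤ ‖D q.2.2‖ ^ 2 := by
      rw [show (2 : ℝ) * σ = σ * 2 by ring, Real.rpow_mul hN0.le, show ((N : ℝ) ^ σ) ^ (2 : ℝ) =
        ((N : ℝ) ^ σ) ^ (2 : ℕ) from by rw [← Real.rpow_natCast]; norm_num]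
      exact pow_le_pow_left₀ (by positivity) hl 2
    refine h1.trans (hstepA _ _ ?_)
    rw [show q.1.1 + q.1.2 - q.2.1 - q.2.2 = q.1.1 + q.1.2 - q.2.1 - q.2.2 from rfl] at hq
    exact hq
  -- Step c: at most three `t₄`
  have hstepC : ∑ q ∈ good, Gτ (q.1.1 + q.1.2 - q.2.1) ≤
      3 * ∑ t₁ ∈ W, ∑ t₂ ∈ W, ∑ t₃ ∈ W, Gτ (t₁ + t₂ - t₃) := by
    rw [hgood, Finset.sum_filter, Finset.sum_product, Finset.mul_sum, Finset.sum_product]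
    refine Finset.sum_le_sum fun t₁ _ ↦ ?_
    rw [Finset.mul_sum]
    refine Finset.sum_le_sum fun t₂ _ ↦ ?_
    rw [Finset.sum_product, Finset.mul_sum]
    refine Finset.sum_le_sum fun t₃ _ ↦ ?_
    simp only
    rw [← Finset.sum_filter, Finset.sum_const, nsmul_eq_mul]
    have hc := card_near_le_three W hsep (t₁ + t₂ - t₃)
    have h0 := hGτ0 (t₁ + t₂ - t₃)
    have : ((W.filter fun t₄ ↦ |t₁ + t₂ - t₃ - t₄| ≤ 1).card : ℝ) ≤ 3 := hc
    nlinarith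
  -- Step d: exchange sum and integral, and the cubic `R`-bound
  have hstepD : ∑ t₁ ∈ W, ∑ t₂ ∈ W, ∑ t₃ ∈ W, Gτ (t₁ + t₂ - t₃) ≤ A * (M₃ * G₀) := by
    have h1 : ∑ t₁ ∈ W, ∑ t₂ ∈ W, ∑ t₃ ∈ W, Gτ (t₁ + t₂ - t₃) =
        A * ∫ s, ∑ t₁ ∈ W, ∑ t₂ ∈ W, ∑ t₃ ∈ W, g s * ‖D (t₁ + t₂ - t₃ + s)‖ ^ 2 := by
      have e3 : ∀ t₁ t₂ : ℝ, ∑ t₃ ∈ W, Gτ (t₁ + t₂ - t₃) =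
          A * ∫ s, ∑ t₃ ∈ W, g s * ‖D (t₁ + t₂ - t₃ + s)‖ ^ 2 := by
        intro t₁ t₂
        rw [integral_finsetSum _ (fun t₃ _ ↦ hIg _), Finset.mul_sum]
      have e2 : ∀ t₁ : ℝ, ∑ t₂ ∈ W, ∑ t₃ ∈ W, Gτ (t₁ + t₂ - t₃) =
          A * ∫ s, ∑ t₂ ∈ W, ∑ t₃ ∈ W, g s * ‖D (t₁ + t₂ - t₃ + s)‖ ^ 2 := by
        intro t₁
        rw [integral_finsetSum _ (fun t₂ _ ↦ integrable_finsetSum _ fun t₃ _ ↦ hIg _),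
          Finset.mul_sum]
        exact Finset.sum_congr rfl fun t₂ _ ↦ e3 t₁ t₂
      rw [integral_finsetSum _ (fun t₁ _ ↦ integrable_finsetSum _ fun t₂ _ ↦
        integrable_finsetSum _ fun t₃ _ ↦ hIg _), Finset.mul_sum]
      exact Finset.sum_congr rfl fun t₁ _ ↦ e2 t₁
    rw [h1]
    refine mul_le_mul_of_nonneg_left ?_ hA0
    have h2 : ∫ s, ∑ t₁ ∈ W, ∑ t₂ ∈ W, ∑ t₃ ∈ W, g s * ‖D (t₁ + t₂ - t₃ + s)‖ ^ 2 ≤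
        ∫ s, g s * M₃ := by
      refine integral_mono (integrable_finsetSum _ fun t₁ _ ↦ integrable_finsetSum _ fun t₂ _ ↦
        integrable_finsetSum _ fun t₃ _ ↦ hIg _) (hgi.mul_const M₃) fun s ↦ ?_
      have hfac : ∑ t₁ ∈ W, ∑ t₂ ∈ W, ∑ t₃ ∈ W, g s * ‖D (t₁ + t₂ - t₃ + s)‖ ^ 2 =
          g s * ∑ t₁ ∈ W, ∑ t₂ ∈ W, ∑ t₃ ∈ W, ‖D (t₁ + t₂ - t₃ + s)‖ ^ 2 := by
        simp only [Finset.mul_sum]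
      simp only
      rw [hfac]
      exact mul_le_mul_of_nonneg_left (triple_sum_normSq_le N hN b hb W s) (hg0 s)
    refine h2.trans (le_of_eq ?_)
    rw [integral_mul_const]; ring
  -- conclusion
  have hpow : (0 : ℝ) < (N : ℝ) ^ (2 * σ) := by positivity
  have hfin : (good.card : ℝ) * (N : ℝ) ^ (2 * σ) ≤ 3 * A * G₀ * M₃ := by
    calc (good.card : ℝ) * (N : ℝ) ^ (2 * σ) ≤ ∑ q ∈ good, Gτ (q.1.1 + q.1.2 - q.2.1) := hstepB
      _ ≤ 3 * ∑ t₁ ∈ W, ∑ t₂ ∈ W, ∑ t₃ ∈ W, Gτ (t₁ + t₂ - t₃) := hstepC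
      _ ≤ 3 * (A * (M₃ * G₀)) := by gcongr
      _ = 3 * A * G₀ * M₃ := by ring
  rw [show (-2 : ℝ) * σ = -(2 * σ) by ring, Real.rpow_neg hN0.le, ← div_eq_mul_inv,
    div_mul_eq_mul_div, le_div_iff₀ hpow]
  linarith [hfin]

end bump

/-- A smoothing bump as in Lemma 11.3 exists: smooth, compactly supported, equal to `1` on
`[0, log 2/(2π)]` (Mathlib's `ContDiffBump`). [cite: GuthMaynard2026, proof of Lemma 11.3] -/
theorem exists_smoothingBump : ∃ ψ : ℝ → ℝ, ContDiff ℝ ∞ ψ ∧ HasCompactSupport ψ ∧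
    ∀ x : ℝ, 0 ≤ x → x ≤ Real.log 2 / (2 * π) → ψ x = 1 := by
  have hc : 0 < Real.log 2 / (4 * π) := by
    have := Real.log_pos one_lt_two; positivity
  let f : ContDiffBump (Real.log 2 / (4 * π)) :=
    ⟨Real.log 2 / (4 * π), 2 * (Real.log 2 / (4 * π)), hc, by linarith⟩
  refine ⟨f, f.contDiff, f.hasCompactSupport, fun x h0 h1 ↦ ?_⟩
  apply f.one_of_mem_closedBall
  rw [Metric.mem_closedBall, Real.dist_eq]
  show |x - Real.log 2 / (4 * π)| ≤ Real.log 2 / (4 * π)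
  rw [abs_le]
  have : Real.log 2 / (2 * π) = 2 * (Real.log 2 / (4 * π)) := by field_simp; ring
  rw [this] at h1
  constructor <;> linarith

/-- **Guth–Maynard Lemma 11.4 with an absolute constant**: there is an absolute `C` such that for
all `N ≥ 1`, real `σ`, `1`-bounded `b_n` and finite `1`-separated `W` with `|∑_{N≤n≤2N} b_n n^{it}| ≥ N^σ`
on `W`, `E(W) ≤ C N^{-2σ} ∑_{n₁,n₂∈[N,2N]} |R(n₁/n₂)|³` (`E(W)` the additive energy
`#{|t₁+t₂−t₃−t₄| ≤ 1}`, the expression of `GuthMaynardAssembly.addEnergy`).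
[cite: GuthMaynard2026, Lemma 11.4] -/
theorem energy_le_third_moment_abs :
    ∃ C, 0 ≤ C ∧ ∀ (N : ℕ), 1 ≤ N → ∀ (σ : ℝ) (b : ℕ → ℂ) (W : Finset ℝ), (∀ n, ‖b n‖ ≤ 1) →
      (∀ t ∈ W, ∀ t' ∈ W, t ≠ t' → 1 ≤ |t - t'|) →
      (∀ t ∈ W, (N : ℝ) ^ σ ≤ ‖∑ n ∈ Finset.Icc N (2 * N), b n * (n : ℂ) ^ ((t : ℂ) * I)‖) →
      ((((W ×ˢ W) ×ˢ (W ×ˢ W)).filter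
          (fun q : (ℝ × ℝ) × (ℝ × ℝ) ↦ |q.1.1 + q.1.2 - q.2.1 - q.2.2| ≤ 1)).card : ℝ) ≤
        C * (N : ℝ) ^ (-2 * σ) * ∑ n₁ ∈ Finset.Icc N (2 * N), ∑ n₂ ∈ Finset.Icc N (2 * N),
          ‖Rfun W ((n₁ : ℝ) / n₂)‖ ^ 3 := by
  obtain ⟨ψ, hψ, hψs, hψ1⟩ := exists_smoothingBump
  exact energy_le_third_moment hψ hψs hψ1

end GuthMaynardEnergy

end Literature.NumberTheory.LFunctions

end
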